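import Summits.ValiantsHypothesis.ValiantsHypothesis.Theorems.KPlusLogSqLawTropicalBMarkedEdgeCoreQExists
import Summits.ValiantsHypothesis.ValiantsHypothesis.Theorems.KPlusLogSqLawTropicalBMarkedEdgeCoreFour

/-!
# Route «KPlusLogSqLaw», crux `TropicalB` (stmt-ValiantsHypothesis-19771) — MARKED-EDGE sector, NESTED-TRIANGLE CORE, ALL sizes:
# `core_S3` — in every realisation the TOP FACTOR of a residual certificate exists: Q₁₈ ∈ BCZ or Q₂₀ ∈ BEZ

HONEST FRAMING.  Helper file (cell `pub-symmetroid`, seat val-sym-trop-p4 (g19), 2026-08-29; `--supports stmt-ValiantsHypothesis-19771 --as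
helper`).  Combines `core_Q_exists` (S3\*, `…CoreQExists`) with g18's b4-rigidity (`core_CEZ_four`, `core_BCZ_four`, `core_BEZ_four`, p670756):
the `(C,E)` alternative of S3\* is impossible in a realisation and the surviving Q-covers have pattern EXACTLY {b1,b4} (slope 18) resp. {b2,b4}
(slope 20).  This is g18's kernel target «`core_Q_exists : Q₁₈ ∈ BCZ ∨ Q₂₀ ∈ BEZ`» (memo ALLM-STRUCTURE-g18 §4b/§6): by the located
FINITE MENU (memo §3) every residual Karamata certificate of the nested-triangle core is topped by such a factor; what remains for the all-m law
is the P-COMPLETION (memo §4f, located 3 000/3 000).  Nothing here proves the law; nothing concerns `TropicalB` in its window, `WeakLifting`,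
the doors, `MatrixDescartes` (stmt-ValiantsHypothesis-18050) or VP ≠ VNP.
-/

set_option linter.dupNamespace false
set_option autoImplicit false

namespace Summit.ValiantsHypothesis.ValiantsHypothesis.Theorems.KPlusLogSqLaw
namespace MarkedEdge
namespace Core

open Finset

variable {V : Type*} [Fintype V] [DecidableEq V]

section Core

variable (ok : V → V → Prop) (w g : V → V → ℤ) (b : Fin 5 → V)

/-- **`core_S3`.**  In any realisation of the nested-triangle core {1,2},{1,3},{2,3},{0,4} (any finite `V`): EITHER there is a cover inside
`σB ⊎ σC ⊎ σZ` with marked fixed points exactly {b1, b4} (a «Q₁₈», slope 18), OR a cover inside `σB ⊎ σE ⊎ σZ` with marked fixed points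
exactly {b2, b4} (a «Q₂₀», slope 20). [this seat's theorem] -/
theorem core_S3 (hb : Function.Injective b)
    (hoff : ∀ i j, j ≠ i → g i j = 0) (hmark : ∀ l, g (b l) (b l) = (2 : ℤ) ^ (l : ℕ)) (haux : ∀ i, (∀ l, b l ≠ i) → g i i = 0)
    {θB θC θE θZ : ℤ} {σB σC σE σZ : Equiv.Perm V}
    (hB : (∀ i, ok i (σB i)) ∧ ∀ τ : Equiv.Perm V, τ ≠ σB → (∀ i, ok i (τ i)) →
      ∑ i, (w i (τ i) + θB * g i (τ i)) < ∑ i, (w i (σB i) + θB * g i (σB i)))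
    (hC : (∀ i, ok i (σC i)) ∧ ∀ τ : Equiv.Perm V, τ ≠ σC → (∀ i, ok i (τ i)) →
      ∑ i, (w i (τ i) + θC * g i (τ i)) < ∑ i, (w i (σC i) + θC * g i (σC i)))
    (hE : (∀ i, ok i (σE i)) ∧ ∀ τ : Equiv.Perm V, τ ≠ σE → (∀ i, ok i (τ i)) →
      ∑ i, (w i (τ i) + θE * g i (τ i)) < ∑ i, (w i (σE i) + θE * g i (σE i)))
    (hZ : (∀ i, ok i (σZ i)) ∧ ∀ τ : Equiv.Perm V, τ ≠ σZ → (∀ i, ok i (τ i)) →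
      ∑ i, (w i (τ i) + θZ * g i (τ i)) < ∑ i, (w i (σZ i) + θZ * g i (σZ i)))
    (hB0 : σB (b 0) ≠ b 0) (hB1 : σB (b 1) = b 1) (hB2 : σB (b 2) = b 2) (hB3 : σB (b 3) ≠ b 3) (hB4 : σB (b 4) ≠ b 4)
    (hC0 : σC (b 0) ≠ b 0) (hC1 : σC (b 1) = b 1) (hC2 : σC (b 2) ≠ b 2) (hC3 : σC (b 3) = b 3) (hC4 : σC (b 4) ≠ b 4)
    (hE0 : σE (b 0) ≠ b 0) (hE1 : σE (b 1) ≠ b 1) (hE2 : σE (b 2) = b 2) (hE3 : σE (b 3) = b 3) (hE4 : σE (b 4) ≠ b 4)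
    (hZ0 : σZ (b 0) = b 0) (hZ1 : σZ (b 1) ≠ b 1) (hZ2 : σZ (b 2) ≠ b 2) (hZ3 : σZ (b 3) ≠ b 3) (hZ4 : σZ (b 4) = b 4) :
    (∃ T : Equiv.Perm V, (∀ i, T i = σB i ∨ T i = σC i ∨ T i = σZ i) ∧
      T (b 0) ≠ b 0 ∧ T (b 1) = b 1 ∧ T (b 2) ≠ b 2 ∧ T (b 3) ≠ b 3 ∧ T (b 4) = b 4) ∨
    (∃ T : Equiv.Perm V, (∀ i, T i = σB i ∨ T i = σE i ∨ T i = σZ i) ∧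
      T (b 0) ≠ b 0 ∧ T (b 1) ≠ b 1 ∧ T (b 2) = b 2 ∧ T (b 3) ≠ b 3 ∧ T (b 4) = b 4) := by
  obtain ⟨hBC, hCE, hEZ⟩ := theta_order ok w g b hb hoff hmark haux hB hC hE hZ hB0 hB1 hB2 hB3 hB4 hC0 hC1 hC2 hC3 hC4
    hE0 hE1 hE2 hE3 hE4 hZ0 hZ1 hZ2 hZ3 hZ4
  rcases core_Q_exists ok w g b hb hoff hmark haux hB hC hE hZ hB0 hB1 hB2 hB3 hB4 hC0 hC1 hC2 hC3 hC4 hE0 hE1 hE2 hE3 hE4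
      hZ0 hZ1 hZ2 hZ3 hZ4 with ⟨T, hT, h4, h1, h0⟩ | ⟨T, hT, h4, h2, h0⟩ | ⟨T, hT, h4, h3, h0⟩
  · obtain ⟨h2, h3⟩ := core_BCZ_four ok w g b hb hoff hmark haux hBC (hCE.trans hEZ) hB hC hZ hB0 hB1 hB2 hB3 hB4 hC0 hC2 hC3
      hC4 hZ0 hZ1 hZ2 hZ3 hZ4 T hT h4 h0
    exact Or.inl ⟨T, hT, h0, h1, h2, h3, h4⟩
  · obtain ⟨h1, h3⟩ := core_BEZ_four ok w g b hb hoff hmark haux (hBC.trans hCE) hEZ hB hE hZ hB0 hB1 hB2 hB3 hB4 hE0 hE1 hE3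
      hE4 hZ0 hZ1 hZ2 hZ3 hZ4 T hT h4 h0
    exact Or.inr ⟨T, hT, h0, h1, h2, h3, h4⟩
  · exact absurd h3 (core_CEZ_four ok w g b hb hoff hmark haux hCE hEZ hC hE hZ hC0 hC1 hC2 hC3 hC4 hE0 hE1 hE2 hE3 hE4 hZ0
      hZ1 hZ2 hZ3 hZ4 T hT h4 h0).2.2

/-- **Slopes of the top factors.**  The Q-cover of `core_S3` has slope 18 (resp. 20). [folklore] -/
theorem core_S3_slopes (hb : Function.Injective b)
    (hoff : ∀ i j, j ≠ i → g i j = 0) (hmark : ∀ l, g (b l) (b l) = (2 : ℤ) ^ (l : ℕ)) (haux : ∀ i, (∀ l, b l ≠ i) → g i i = 0)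
    (T : Equiv.Perm V) (h0 : T (b 0) ≠ b 0) (h3 : T (b 3) ≠ b 3) (h4 : T (b 4) = b 4) :
    (T (b 1) = b 1 → T (b 2) ≠ b 2 → (∑ i, g i (T i)) = 18) ∧ (T (b 1) ≠ b 1 → T (b 2) = b 2 → (∑ i, g i (T i)) = 20) := by
  constructor
  · intro h1 h2
    rw [slope_eq_sum_marked g b hb hoff hmark haux T, Fin.sum_univ_five]
    simp [h0, h1, h2, h3, h4]
  · intro h1 h2
    rw [slope_eq_sum_marked g b hb hoff hmark haux T, Fin.sum_univ_five]
    simp [h0, h1, h2, h3, h4]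

end Core

end Core
end MarkedEdge
end Summit.ValiantsHypothesis.ValiantsHypothesis.Theorems.KPlusLogSqLaw
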